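import Literature.NumberTheory.QuadraticForms.HilbertSymbolPrescribedHolds
import Literature.NumberTheory.QuadraticForms.LocalNormIndex
import Literature.NumberTheory.QuadraticForms.HilbertSymbolArchimedean
import HarnessLib

/-!
# Global elements with prescribed local norm classes and prescribed real signs (quadratic case)

Topic `NumberTheory/QuadraticForms`, namespace `Literature.NumberTheory.QuadraticForms`.  Theorems only
(no definition, no named fact, no `sorry`); everything is deduced from tree theorems: O'Meara 71:19/71:19a
(`exists_hilbertSymbol_eq_neg_one_iff_holds`, elements with prescribed Hilbert symbols), Hilbert's
reciprocity law 71:18 (`hilbertReciprocity_holds`), the local norm index 63:13a at every finite place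
(`index_quadraticNormSubgroup_adicCompletion_eq_two`), the link «local norm ⟺ Hilbert symbol `1`» 65A
(`hilbertSymbol_eq_one_iff_mem_quadraticNormSubgroup`) and the archimedean symbol
(`hilbertSymbol_completion_eq_neg_one_iff_of_isReal`, `hilbertSymbol_completion_eq_one_of_isComplex`).

For a number field `K` and `a ∈ Kˣ` put `E = K(√a)`.  The idèle class group statement
«`ker (∏_v (·, a)_v : J_K → {±1}) = Kˣ · N_{E/K} J_E`» (class field theory for the quadratic extension
`E/K`: reciprocity gives `⊆`, the norm index `(J_K : Kˣ N J_E) = 2` gives equality) says, place by place: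
a family of LOCAL NORM CLASSES `ε_v ∈ K_vˣ / N(E_vˣ)` at the finite places together with a family of SIGNS at
the real places (where `a < 0`) is realised by ONE global `θ ∈ Kˣ` iff the number of non-trivial
prescriptions is EVEN.  This file states and proves exactly that, in the tree's Hilbert-symbol clothing:

* `exists_hilbertSymbol_eq_neg_one_sets_iff_even` — for `a` a non-square at the places of `S ∪ T` (`S` finite
  places, `T` real places): «`∃ θ ≠ 0` with `(θ, a)_𝔭 = -1` exactly on `S ∪ T`» `↔` «`|S| + |T|` even»
  (`←` is 71:19 verbatim, `→` is 71:18);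
* `exists_prescribed_normClass_sign_iff_even` — for `a` NEGATIVE AT EVERY REAL PLACE (the CM situation:
  `K` totally real or not, `E = K(√a)` with `a` totally negative at the real places), a family
  `ε = (ε_v)_v`, `ε_v ∈ K_vˣ / N(E_vˣ)` (the tree's carrier of [Liu2021, Def. 4.11] collections,
  `Liu2021.Def411WeilCarriers.Eps K a`, written out) and a finite set `T` of real places:
  «`∃ θ ∈ Kˣ` whose local class is `ε_v` at every finite `v` and with `w(θ) < 0` exactly for `w ∈ T`»
  `↔` «`{v | ε_v ≠ 1}` is finite and `#{v | ε_v ≠ 1} + #T` is even».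

APPLICATION (why this is the first rung of the cell hodgecm-mathlib's line (T4) «Rogawski multiplicity one»,
`B-provers/READFIRST-ROG-multone.md` §5 S6/G2b): with `K = F⁺` totally real, `E = F` a CM field, `a = δ²` for
`δ ∈ F^{×−}` (so `a` is totally negative), Liu's «`ε` is `μ`-admissible» ([Liu2021, Def. 4.12]: `∃ e ∈ E^{×−}`
with `ε_v = e · N(E_vˣ)` for all finite `v` and `Im τ′(e) < 0` for `τ′ ∈ Φ_μ`) reads, writing `e = θ·δ` with
`θ ∈ Kˣ`: `θ` has local classes `ε_v/δ` and signs `sgn τ(θ) = -sgn Im τ′(δ)` — i.e. it is the left side of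
`exists_prescribed_normClass_sign_iff_even` with `T = {τ : Im τ′(δ) > 0}`; the right side is the PARITY
condition that the (corrected) multiplicity formula of [Rogawski1990, Thm. 14.6.4] / [Rogawski1992]
imposes.  That translation (Liu's carriers `epsOf`, `IsAdmissibleElement`) is NOT done here; this file is
pure number theory over Mathlib's completions.

## References
* O. T. O'Meara, *Introduction to Quadratic Forms*, Grundlehren 117 (1963): §63B Cor. 63:13a, §65A,
  Prop. 65:21, §71 Thm. 71:18, Thm. 71:19 + Cor. 71:19a. [Omeara1963]
* Y. Liu, *Fourier–Jacobi cycles and arithmetic relative trace formula*, Camb. J. Math. 9 (2021),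
  Def. 4.11–4.12 (FJcycle.tex ll. 2083–2108). [Liu2021]
-/

noncomputable section

open NumberField IsDedekindDomain

namespace Literature.NumberTheory.QuadraticForms

variable (K : Type) [Field K] [NumberField K]

/-- **Prescribed Hilbert symbols: existence ⟺ parity** (O'Meara 71:19/71:19a and 71:18 combined).  For
`a ∈ K`, a finite set `S` of finite places and a finite set `T` of real places such that `a` is a
non-square in `K_v` (`v ∈ S`) and in `K_w` (`w ∈ T`): there is `θ ≠ 0` with `(θ, a)_v = -1` exactly for the
finite places `v ∈ S` and `(θ, a)_w = -1` exactly for the infinite places `w ∈ T`, if and only if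
`|S| + |T|` is even.  [cite: Omeara1963, §71 Thm. 71:19, Cor. 71:19a, Thm. 71:18] -/
theorem exists_hilbertSymbol_eq_neg_one_sets_iff_even (a : K) (S : Finset (HeightOneSpectrum (𝓞 K)))
    (T : Finset (InfinitePlace K)) (hT : ∀ w ∈ T, w.IsReal)
    (hS : ∀ v ∈ S, ¬ IsSquare (algebraMap K (v.adicCompletion K) a))
    (hTa : ∀ w ∈ T, ¬ IsSquare (algebraMap K w.Completion a)) :
    (∃ θ : K, θ ≠ 0 ∧
      (∀ v : HeightOneSpectrum (𝓞 K),
        hilbertSymbol (v.adicCompletion K) (algebraMap K _ θ) (algebraMap K _ a) = -1 ↔ v ∈ S) ∧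
      (∀ w : InfinitePlace K,
        hilbertSymbol w.Completion (algebraMap K _ θ) (algebraMap K _ a) = -1 ↔ w ∈ T)) ↔
    Even (S.card + T.card) := by
  constructor
  · rintro ⟨θ, hθ, hfin, hinf⟩
    by_cases ha : a = 0
    · have hS0 : S = ∅ := Finset.eq_empty_of_forall_notMem fun v hv =>
        hS v hv (by rw [ha, map_zero]; exact ⟨0, (mul_zero _).symm⟩)
      have hT0 : T = ∅ := Finset.eq_empty_of_forall_notMem fun w hw =>
        hTa w hw (by rw [ha, map_zero]; exact ⟨0, (mul_zero _).symm⟩)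
      simp [hS0, hT0]
    · obtain ⟨-, heven⟩ := hilbertReciprocity_holds K θ a hθ ha
      have h1 : {v : HeightOneSpectrum (𝓞 K) |
          hilbertSymbol (v.adicCompletion K) (algebraMap K _ θ) (algebraMap K _ a) = -1} = ↑S := by
        ext v
        simp only [Set.mem_setOf_eq, Finset.mem_coe]
        exact hfin v
      have h2 : {w : InfinitePlace K |
          hilbertSymbol w.Completion (algebraMap K _ θ) (algebraMap K _ a) = -1} = ↑T := by
        ext w
        simp only [Set.mem_setOf_eq, Finset.mem_coe]
        exact hinf w
      rw [h1, h2, Set.ncard_coe_finset, Set.ncard_coe_finset] at heven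
      exact heven
  · intro heven
    exact exists_hilbertSymbol_eq_neg_one_iff_holds K a S T hT heven hS hTa

variable {K}

/-- In the local norm class group `K_vˣ / N(K_v(√a)ˣ)` (order `≤ 2`, O'Meara 63:13a) two non-trivial
classes coincide. [cite: Omeara1963, §63B Cor. 63:13a] -/
theorem quotient_quadraticNormSubgroup_eq_of_ne_one (v : HeightOneSpectrum (𝓞 K)) {a : K} (ha : a ≠ 0)
    {x y : (v.adicCompletion K)ˣ ⧸
      quadraticNormSubgroup (v.adicCompletion K) (algebraMap K (v.adicCompletion K) a)}
    (hx : x ≠ 1) (hy : y ≠ 1) : x = y := by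
  haveI : CharZero (v.adicCompletion K) :=
    charZero_of_injective_algebraMap (algebraMap K _).injective
  have ha' : algebraMap K (v.adicCompletion K) a ≠ 0 := (map_ne_zero _).2 ha
  -- `a` is a non-square in `K_v`: otherwise the norm group is everything and `x = 1`
  have hns : ¬ IsSquare (algebraMap K (v.adicCompletion K) a) := by
    intro hsq
    apply hx
    induction x using QuotientGroup.induction_on with
    | H t =>
      rw [QuotientGroup.eq_one_iff, quadraticNormSubgroup_eq_top_of_isSquare hsq ha']
      exact Subgroup.mem_top t
  have hcard : Nat.card ((v.adicCompletion K)ˣ ⧸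
      quadraticNormSubgroup (v.adicCompletion K) (algebraMap K (v.adicCompletion K) a)) = 2 :=
    index_quadraticNormSubgroup_adicCompletion_eq_two K v ha' hns
  obtain ⟨z, hz, hzu⟩ := (Nat.card_eq_two_iff' (1 : (v.adicCompletion K)ˣ ⧸
      quadraticNormSubgroup (v.adicCompletion K) (algebraMap K (v.adicCompletion K) a))).1 hcard
  rw [hzu x hx, hzu y hy]

/-- The class of a local unit `t` in `K_vˣ / N(K_v(√a)ˣ)` is trivial iff `(t, a)_v = 1` (O'Meara §65A:
«`α` is a local norm at `𝔭` iff `(α, θ)_𝔭 = 1`»). [cite: Omeara1963, §65A] -/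
theorem mk_quadraticNormSubgroup_eq_one_iff_hilbertSymbol (v : HeightOneSpectrum (𝓞 K)) {a : K} (ha : a ≠ 0)
    (t : (v.adicCompletion K)ˣ) :
    (QuotientGroup.mk t : (v.adicCompletion K)ˣ ⧸
        quadraticNormSubgroup (v.adicCompletion K) (algebraMap K (v.adicCompletion K) a)) = 1 ↔
      hilbertSymbol (v.adicCompletion K) (t : v.adicCompletion K) (algebraMap K _ a) = 1 := by
  haveI : CharZero (v.adicCompletion K) :=
    charZero_of_injective_algebraMap (algebraMap K _).injective
  rw [QuotientGroup.eq_one_iff,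
    hilbertSymbol_eq_one_iff_mem_quadraticNormSubgroup ((map_ne_zero _).2 ha) t]

/-- … and non-trivial iff `(t, a)_v = -1`. [cite: Omeara1963, §65A] -/
theorem mk_quadraticNormSubgroup_ne_one_iff_hilbertSymbol (v : HeightOneSpectrum (𝓞 K)) {a : K} (ha : a ≠ 0)
    (t : (v.adicCompletion K)ˣ) :
    (QuotientGroup.mk t : (v.adicCompletion K)ˣ ⧸
        quadraticNormSubgroup (v.adicCompletion K) (algebraMap K (v.adicCompletion K) a)) ≠ 1 ↔
      hilbertSymbol (v.adicCompletion K) (t : v.adicCompletion K) (algebraMap K _ a) = -1 := by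
  rw [Ne, mk_quadraticNormSubgroup_eq_one_iff_hilbertSymbol v ha t, ← hilbertSymbol_ne_one_iff]

omit [NumberField K] in
/-- At a real place `w` where `a < 0`: `(θ, a)_w = -1` iff `w(θ) < 0`, for `θ ≠ 0`. [cite: Omeara1963, §63 (archimedean spots)] -/
theorem hilbertSymbol_completion_eq_neg_one_iff_neg {w : InfinitePlace K} (hw : w.IsReal) {a θ : K}
    (ha : InfinitePlace.embedding_of_isReal hw a < 0) (hθ : θ ≠ 0) :
    hilbertSymbol w.Completion (algebraMap K _ θ) (algebraMap K _ a) = -1 ↔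
      InfinitePlace.embedding_of_isReal hw θ < 0 := by
  rw [hilbertSymbol_completion_eq_neg_one_iff_of_isReal hw]
  have hθ' : InfinitePlace.embedding_of_isReal hw θ ≠ 0 := (_root_.map_ne_zero _).2 hθ
  constructor
  · exact fun h => lt_of_le_of_ne h.1 hθ'
  · exact fun h => ⟨h.le, ha.le⟩

omit [NumberField K] in
/-- A negative real number is not a square: at a real place `w` with `w(a) < 0`, `a` is a non-square in
`K_w` (private helper). [folklore] -/
private theorem not_isSquare_completion_of_neg {w : InfinitePlace K} (hw : w.IsReal) {a : K}
    (ha : InfinitePlace.embedding_of_isReal hw a < 0) : ¬ IsSquare (algebraMap K w.Completion a) := by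
  rintro ⟨r, hr⟩
  have h := congrArg (InfinitePlace.Completion.ringEquivRealOfIsReal hw) hr
  rw [ringEquivRealOfIsReal_algebraMap, map_mul] at h
  have : 0 ≤ InfinitePlace.embedding_of_isReal hw a := by rw [h]; exact mul_self_nonneg _
  exact absurd ha (not_lt.2 this)

variable (K)

/-- **Prescribed local norm classes and real signs: existence ⟺ parity.**  Let `a ∈ Kˣ` be negative at every
real place of `K` (e.g. `K` totally real and `K(√a)` CM, or any `a` if `K` is totally complex).  Given, at
every finite place `v`, a class `ε_v ∈ K_vˣ / N(K_v(√a)ˣ)` and a finite set `T` of real places, there is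
`θ ∈ Kˣ` with local class `ε_v` at every finite `v` and with `w(θ) < 0` exactly for the real places
`w ∈ T` if and only if `{v | ε_v ≠ 1}` is finite and `#{v | ε_v ≠ 1} + #T` is even.  (`→`: Hilbert
reciprocity 71:18 and «norm ⟺ symbol `1`»; `←`: 71:19/71:19a at `S = {v | ε_v ≠ 1}` and the local norm index
`2`, 63:13a, to pass from equal symbols to equal classes.)  This is the quadratic case of
«`J_K / Kˣ N_{E/K} J_E ≅ ℤ/2`» read componentwise.
[cite: Omeara1963, §71 Thm. 71:19, Cor. 71:19a, Thm. 71:18; §63B Cor. 63:13a; §65A] -/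
theorem exists_prescribed_normClass_sign_iff_even (a : K) (ha : a ≠ 0)
    (hneg : ∀ (w : InfinitePlace K) (hw : w.IsReal), InfinitePlace.embedding_of_isReal hw a < 0)
    (ε : ∀ v : HeightOneSpectrum (𝓞 K),
      (v.adicCompletion K)ˣ ⧸ quadraticNormSubgroup (v.adicCompletion K) (algebraMap K (v.adicCompletion K) a))
    (T : Finset (InfinitePlace K)) (hT : ∀ w ∈ T, w.IsReal) :
    (∃ θ : Kˣ,
      (∀ v : HeightOneSpectrum (𝓞 K),
        (QuotientGroup.mk (Units.map (algebraMap K (v.adicCompletion K)).toMonoidHom θ) :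
          (v.adicCompletion K)ˣ ⧸
            quadraticNormSubgroup (v.adicCompletion K) (algebraMap K (v.adicCompletion K) a)) = ε v) ∧
      (∀ (w : InfinitePlace K) (hw : w.IsReal),
        InfinitePlace.embedding_of_isReal hw (θ : K) < 0 ↔ w ∈ T)) ↔
    ({v : HeightOneSpectrum (𝓞 K) | ε v ≠ 1}.Finite ∧
      Even ({v : HeightOneSpectrum (𝓞 K) | ε v ≠ 1}.ncard + T.card)) := by
  constructor
  · rintro ⟨θ, hcl, hsg⟩
    have hθ : (θ : K) ≠ 0 := θ.ne_zero
    obtain ⟨hfinite, heven⟩ := hilbertReciprocity_holds K (θ : K) a hθ ha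
    -- the finite places with symbol `-1` are exactly those with `ε_v ≠ 1`
    have h1 : {v : HeightOneSpectrum (𝓞 K) |
        hilbertSymbol (v.adicCompletion K) (algebraMap K _ (θ : K)) (algebraMap K _ a) = -1} =
        {v | ε v ≠ 1} := by
      ext v
      simp only [Set.mem_setOf_eq]
      rw [← hcl v, mk_quadraticNormSubgroup_ne_one_iff_hilbertSymbol v ha]
      rfl
    -- the infinite places with symbol `-1` are exactly those of `T`
    have h2 : {w : InfinitePlace K |
        hilbertSymbol w.Completion (algebraMap K _ (θ : K)) (algebraMap K _ a) = -1} = ↑T := by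
      ext w
      simp only [Set.mem_setOf_eq, Finset.mem_coe]
      by_cases hw : w.IsReal
      · rw [hilbertSymbol_completion_eq_neg_one_iff_neg hw (hneg w hw) hθ]
        exact hsg w hw
      · have hc : w.IsComplex := InfinitePlace.not_isReal_iff_isComplex.1 hw
        rw [hilbertSymbol_completion_eq_one_of_isComplex hc (Or.inl hθ)]
        exact ⟨fun h => absurd h (by decide), fun h => absurd (hT w h) hw⟩
    rw [h1] at hfinite
    rw [h1, h2, Set.ncard_coe_finset] at heven
    exact ⟨hfinite, heven⟩
  · rintro ⟨hfinite, heven⟩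
    set S : Finset (HeightOneSpectrum (𝓞 K)) := hfinite.toFinset with hSdef
    have hmemS : ∀ v, v ∈ S ↔ ε v ≠ 1 := fun v => by rw [hSdef, Set.Finite.mem_toFinset]; rfl
    have hScard : S.card = {v : HeightOneSpectrum (𝓞 K) | ε v ≠ 1}.ncard := by
      rw [hSdef, ← Set.ncard_coe_finset, Set.Finite.coe_toFinset]
    have hS : ∀ v ∈ S, ¬ IsSquare (algebraMap K (v.adicCompletion K) a) := by
      intro v hv hsq
      haveI : CharZero (v.adicCompletion K) :=
        charZero_of_injective_algebraMap (algebraMap K _).injective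
      apply (hmemS v).1 hv
      induction ε v using QuotientGroup.induction_on with
      | H t =>
        rw [QuotientGroup.eq_one_iff, quadraticNormSubgroup_eq_top_of_isSquare hsq ((map_ne_zero _).2 ha)]
        exact Subgroup.mem_top t
    have hTa : ∀ w ∈ T, ¬ IsSquare (algebraMap K w.Completion a) := fun w hw =>
      not_isSquare_completion_of_neg (hT w hw) (hneg w (hT w hw))
    have heven' : Even (S.card + T.card) := by rw [hScard]; exact heven
    obtain ⟨θ, hθ, hfin, hinf⟩ := exists_hilbertSymbol_eq_neg_one_iff_holds K a S T hT heven' hS hTa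
    refine ⟨Units.mk0 θ hθ, fun v => ?_, fun w hw => ?_⟩
    · -- equal symbols ⇒ equal classes
      by_cases hv : ε v = 1
      · rw [hv, mk_quadraticNormSubgroup_eq_one_iff_hilbertSymbol v ha]
        have hvS : v ∉ S := fun h => (hmemS v).1 h hv
        rw [← hfin v] at hvS
        simpa [Units.coe_map, Units.val_mk0] using (hilbertSymbol_ne_neg_one_iff _ _).1 hvS
      · refine quotient_quadraticNormSubgroup_eq_of_ne_one v ha ?_ hv
        rw [mk_quadraticNormSubgroup_ne_one_iff_hilbertSymbol v ha]
        have hvS : v ∈ S := (hmemS v).2 hv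
        rw [← hfin v] at hvS
        simpa [Units.coe_map, Units.val_mk0] using hvS
    · rw [Units.val_mk0, ← hilbertSymbol_completion_eq_neg_one_iff_neg hw (hneg w hw) hθ]
      exact hinf w

/-- **Finitely supported families of local norm classes are GLOBAL** (the quadratic norm-index theorem read with the
real places as the parity valve): let `K` have at least one real place and let `a ∈ Kˣ` be negative at every real place.
If the class `ε_v ∈ K_vˣ / N(K_v(√a)ˣ)` is non-trivial only for finitely many finite places `v`, then some `θ ∈ Kˣ` has
class `ε_v` at EVERY finite place (its real signs absorb the parity: `T = ∅` or `T = {w₀}`).  Application (cell hodgecm-mathlib,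
E-III2): for Liu's collections `ε` ([Liu2021, Def. 4.11 second bullet], carrier `Def411WeilCarriers.Eps K a` = this product,
`locF` = these classes) the guard «`{v | ε_v ≠ 1}` finite» — the `δ`-normalised form of the printed proviso «`ε_v ∈ O^× · Nm`
for all but finitely many `v`» (l. 2088) — already forces `ε = locF θ` for a global `θ`, so a consumer reading `ω(μ, ε, χ)` on
the line of a global representative never meets the junk branch.
[cite: Omeara1963, §65 Prop. 65:21, §71 Thm. 71:19, Cor. 71:19a] [cite: Liu2021, Def. 4.11 (l. 2088)] -/
theorem exists_prescribed_normClass_of_finite (a : K) (ha : a ≠ 0)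
    (hneg : ∀ (w : InfinitePlace K) (hw : w.IsReal), InfinitePlace.embedding_of_isReal hw a < 0)
    (w₀ : InfinitePlace K) (hw₀ : w₀.IsReal)
    (ε : ∀ v : HeightOneSpectrum (𝓞 K),
      (v.adicCompletion K)ˣ ⧸ quadraticNormSubgroup (v.adicCompletion K) (algebraMap K (v.adicCompletion K) a))
    (hfin : {v : HeightOneSpectrum (𝓞 K) | ε v ≠ 1}.Finite) :
    ∃ θ : Kˣ, ∀ v : HeightOneSpectrum (𝓞 K),
      (QuotientGroup.mk (Units.map (algebraMap K (v.adicCompletion K)).toMonoidHom θ) :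
        (v.adicCompletion K)ˣ ⧸
          quadraticNormSubgroup (v.adicCompletion K) (algebraMap K (v.adicCompletion K) a)) = ε v := by
  classical
  -- choose the real-sign set `T` so that the total number of conditions is even
  by_cases hpar : Even {v : HeightOneSpectrum (𝓞 K) | ε v ≠ 1}.ncard
  · obtain ⟨θ, hθ, -⟩ := (exists_prescribed_normClass_sign_iff_even K a ha hneg ε ∅ (by simp)).2
      ⟨hfin, by simpa using hpar⟩
    exact ⟨θ, hθ⟩
  · obtain ⟨θ, hθ, -⟩ := (exists_prescribed_normClass_sign_iff_even K a ha hneg ε {w₀} (by simpa using hw₀)).2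
      ⟨hfin, by
        rw [Finset.card_singleton]
        exact Nat.even_add_one.2 hpar⟩
    exact ⟨θ, hθ⟩

end Literature.NumberTheory.QuadraticForms

end
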